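import Mathlib
import Summits.SmoothPoincare4.SmoothPoincare4.Theses.CylinderEntropy
import Literature.Topology.FourManifolds.Morse

/-!
# Sketch — crux-ideate stmt-SmoothPoincare4-7633 (CylinderEntropy.ThinCrossSectionExists), ideator 2

Card `ladder-split-root-2pi-e`: split the existence crux E at the S¹×ℝ³ rung.

* `cylEntropy A`       — the route's cylinder entropy λ_cyl of a set A ⊆ ℝ⁶ (verbatim sup of the items);
* `CrossSectionBelow c M` — M has an end-separating smooth embedding into N = S⁴×ℝ with λ_cyl < c;
* `ThinAtLevel c`      — every homotopy 4-sphere has one;  E = `ThinAtLevel (4/e)` (checked: `Iff.rfl`);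
* `RungThreeThin`      — E₃ := `ThinAtLevel √(2π/e)`   (⟺ B "bounds a contractible 2-handlebody", given
                         the rung-3 recognition and `ChimneyBound`);
* `GapThreeTwo`        — Gap₃₂ := rung-3-thin ⇒ rung-2-thin, pointwise in M (⟺ T "presentation spheres are
                         standard", given CylinderRungTwo and `ChimneyBound`);
* `split`              — E₃ → Gap₃₂ → E (pure logic, proved);
* `Bounds₂ M`          — EntropyLadder's "M bounds a compact contractible smooth 5-manifold with an adapted
                         Morse function of index ≤ 2" (verbatim shape of `BoundsContractibleTwoHandlebody`);
* `ChimneyBound`       — FIRST LEMMA (U₂_cyl): Bounds₂ M ⇒ ∀ δ > 0, CrossSectionBelow (4/e + δ) M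
                         (slice + thin arches + bubble-sheet chimneys over embedded core discs, trumpet
                         junctions, separated scales — inside N);
* `TopRungBound`       — U₃_cyl: every homotopy 4-sphere is CrossSectionBelow (√(2π/e) + δ) for all δ > 0
                         (Kervaire–Milnor h-cobordism realised thinly in N: 3-handle cores as S¹-tubes).
-/

noncomputable section

open scoped BigOperators Topology Manifold Classical MeasureTheory ENNReal ContinuousMap ContDiff
open Filter Set Function TopologicalSpace MeasureTheory

namespace Summit.SmoothPoincare4.SmoothPoincare4.Cruxes.ThinCrossSectionExists.LadderSplit

/-- Local notation for the model spaces. -/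
local notation "E⁶" => EuclideanSpace ℝ (Fin 6)
local notation "𝕊⁴" => Metric.sphere (0 : EuclideanSpace ℝ (Fin 5)) 1

/-- The route's cylinder entropy λ_cyl(A) of a subset A ⊆ N ⊂ ℝ⁶ (sup over centres p ∈ N and scales τ > 0 of
the slice-normalised backward-heat-kernel area; copied verbatim from the items of route CylinderEntropy). -/
def cylEntropy (A : Set E⁶) : ℝ≥0∞ :=
  ⨆ (p : E⁶) (_ : ∑ i : Fin 5, p (Fin.castSucc i) ^ 2 = 1) (τ : ℝ) (_ : 0 < τ),
    (μH[4] (Metric.sphere (0 : EuclideanSpace ℝ (Fin 5)) 1))⁻¹ *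
      ∫⁻ z in A, ENNReal.ofReal ((∑' k : ℕ, Real.exp (-((k : ℝ) * ((k : ℝ) + 3)) * τ) *
        ((2 * (k : ℝ) + 3) / 3) * ∑ l ∈ Finset.range (k / 2 + 1), (-1 : ℝ) ^ l *
          (∏ j ∈ Finset.range (k - l), ((3 : ℝ) / 2 + (j : ℝ))) /
            (((l.factorial : ℕ) : ℝ) * (((k - 2 * l).factorial : ℕ) : ℝ)) *
          (2 * ∑ i : Fin 5, z (Fin.castSucc i) * p (Fin.castSucc i)) ^ (k - 2 * l)) *
        Real.exp (-((z 5 - p 5) ^ 2) / (4 * τ))) ∂μH[4]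

/-- `M` admits an end-separating smooth embedding into N = {∑_{i<5} z_i² = 1} ⊂ ℝ⁶ of cylinder entropy `< c`
(the four conjuncts of the route's items, with the threshold as a parameter). -/
def CrossSectionBelow (c : ℝ≥0∞) (M : Type) [TopologicalSpace M] [ChartedSpace (EuclideanSpace ℝ (Fin 4)) M] :
    Prop :=
  ∃ ι : M → E⁶, Manifold.IsSmoothEmbedding (𝓡 4) (𝓡 6) ∞ ι ∧
    (∀ x, ∑ i : Fin 5, ι x (Fin.castSucc i) ^ 2 = 1) ∧
    (∃ R : ℝ, ∀ a b : E⁶, ∑ i : Fin 5, a (Fin.castSucc i) ^ 2 = 1 → ∑ i : Fin 5, b (Fin.castSucc i) ^ 2 = 1 →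
      a 5 ≤ -R → R ≤ b 5 → ¬ JoinedIn ({z : E⁶ | ∑ i : Fin 5, z (Fin.castSucc i) ^ 2 = 1} \ Set.range ι) a b) ∧
    cylEntropy (Set.range ι) < c

/-- Every homotopy 4-sphere (bare summit shape) is `CrossSectionBelow c`. -/
def ThinAtLevel (c : ℝ≥0∞) : Prop :=
  ∀ (M : Type) [TopologicalSpace M] [T2Space M] [SecondCountableTopology M]
    [ChartedSpace (EuclideanSpace ℝ (Fin 4)) M] [IsManifold (𝓡 4) ∞ M],
    M ≃ₕ 𝕊⁴ → CrossSectionBelow c M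

/-- The bubble-sheet threshold λ(S²×ℝ²) = 4/e and the next rung λ(S¹×ℝ³) = √(2π/e) (Stone). -/
def levelTwo : ℝ≥0∞ := ENNReal.ofReal (4 / Real.exp 1)
def levelThree : ℝ≥0∞ := ENNReal.ofReal (Real.sqrt (2 * Real.pi / Real.exp 1))

/-- Sanity: the crux E is literally `ThinAtLevel (4/e)`. -/
example : Summit.SmoothPoincare4.SmoothPoincare4.Theses.CylinderEntropy.ThinCrossSectionExists ↔
    ThinAtLevel levelTwo := Iff.rfl

/-- E₃ — existence one rung up: every homotopy 4-sphere has a cross-section with λ_cyl < λ(S¹×ℝ³). -/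
def RungThreeThin : Prop := ThinAtLevel levelThree

/-- Gap₃₂ — the gap at the bubble-sheet level, pointwise: a homotopy 4-sphere with SOME cross-section below
λ(S¹×ℝ³) has one below λ(S²×ℝ²) = 4/e. -/
def GapThreeTwo : Prop :=
  ∀ (M : Type) [TopologicalSpace M] [T2Space M] [SecondCountableTopology M]
    [ChartedSpace (EuclideanSpace ℝ (Fin 4)) M] [IsManifold (𝓡 4) ∞ M],
    M ≃ₕ 𝕊⁴ → CrossSectionBelow levelThree M → CrossSectionBelow levelTwo M

/-- The split is pure logic. -/
theorem split (h₃ : RungThreeThin) (hgap : GapThreeTwo) :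
    Summit.SmoothPoincare4.SmoothPoincare4.Theses.CylinderEntropy.ThinCrossSectionExists := by
  intro M _ _ _ _ _ e
  exact hgap M e (h₃ M e)

/-- EntropyLadder's interface (verbatim shape of `BoundsContractibleTwoHandlebody`): `M` bounds a compact
contractible smooth 5-manifold carrying an adapted Morse function all of whose critical points have index ≤ 2
(a 5-dimensional 2-handlebody; = a presentation sphere ∂H⁵(P,ε) when `M ≃ₕ S⁴`). -/
def Bounds₂ (M : Type) [TopologicalSpace M] [ChartedSpace (EuclideanSpace ℝ (Fin 4)) M] : Prop :=
  ∃ (W : Type) (_ : TopologicalSpace W) (_ : T2Space W) (_ : SecondCountableTopology W)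
    (_ : ChartedSpace (EuclideanHalfSpace (4 + 1)) W) (_ : IsManifold (𝓡∂ (4 + 1)) ∞ W) (_ : CompactSpace W),
    ContractibleSpace W ∧
    (∃ f : W → ℝ, Literature.Topology.FourManifolds.IsMorseAdapted (𝓡∂ (4 + 1)) f ∧
      ∀ z, Literature.Topology.FourManifolds.IsMCriticalPt (𝓡∂ (4 + 1)) f z →
        Literature.Topology.FourManifolds.morseIndex (𝓡∂ (4 + 1)) f z ≤ 2) ∧
    ∃ φ : M → W, Manifold.IsSmoothEmbedding (𝓡 4) (𝓡∂ (4 + 1)) ∞ φ ∧ Set.range φ = (𝓡∂ (4 + 1)).boundary W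

/-- **FIRST LEMMA (U₂_cyl, "chimney bound").** A homotopy 4-sphere bounding a contractible 5-dimensional
2-handlebody has end-separating embeddings into S⁴×ℝ of cylinder entropy below 4/e + δ for every δ > 0:
realise ∂(D⁵ ∪ k 1-handles ∪ k 2-handles) inside N as (slice ∪ k thin arches S³_ε×I) surgered along the k
relator circles by bubble-sheet chimneys D_i × S²_η (η ≪ ε) over pairwise disjoint embedded core discs D_i in
the simply connected region above, with trumpet junctions; local densities: slice 1, necks λ(S³×ℝ)(1+o(1)),
sheets λ(S²×ℝ²)(1+o(1)), junctions ≤ λ(S²×ℝ²)+o(1) (the trumpet lemma, kit job j006356), large scales → 1. -/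
def ChimneyBound : Prop :=
  ∀ (M : Type) [TopologicalSpace M] [T2Space M] [SecondCountableTopology M]
    [ChartedSpace (EuclideanSpace ℝ (Fin 4)) M] [IsManifold (𝓡 4) ∞ M],
    M ≃ₕ 𝕊⁴ → Bounds₂ M → ∀ δ : ℝ, 0 < δ → CrossSectionBelow (ENNReal.ofReal (4 / Real.exp 1 + δ)) M

/-- **U₃_cyl ("top-rung bound").** Every homotopy 4-sphere has cross-sections of cylinder entropy below
√(2π/e) + δ for every δ > 0 (its Kervaire–Milnor h-cobordism to the slice, S⁴×I ∪ 2-handles ∪ 3-handles,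
realised inside N with thin arches, chimneys and S¹_θ-tubes Δ_j × S¹_θ over the 3-handle cores, θ ≪ η ≪ ε).
Hence inf λ_cyl over cross-sections of any Σ is ≤ √(2π/e): E₃ is exactly "the infimum is not the top value". -/
def TopRungBound : Prop :=
  ∀ δ : ℝ, 0 < δ → ThinAtLevel (ENNReal.ofReal (Real.sqrt (2 * Real.pi / Real.exp 1) + δ))

/-- Dictionary, easy direction (B ⇒ E₃ via the chimney bound): uses only 4/e < √(2π/e). -/
theorem rungThree_of_bounds (hB : ∀ (M : Type) [TopologicalSpace M] [T2Space M] [SecondCountableTopology M]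
      [ChartedSpace (EuclideanSpace ℝ (Fin 4)) M] [IsManifold (𝓡 4) ∞ M], M ≃ₕ 𝕊⁴ → Bounds₂ M)
    (hU : ChimneyBound)
    (hnum : 4 / Real.exp 1 < Real.sqrt (2 * Real.pi / Real.exp 1)) : RungThreeThin := by
  intro M _ _ _ _ _ e
  set δ : ℝ := Real.sqrt (2 * Real.pi / Real.exp 1) - 4 / Real.exp 1 with hδ
  have hδpos : 0 < δ := by rw [hδ]; linarith
  obtain ⟨ι, h1, h2, h3, h4⟩ := hU M e (hB M e) δ hδpos
  refine ⟨ι, h1, h2, h3, ?_⟩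
  have : ENNReal.ofReal (4 / Real.exp 1 + δ) = levelThree := by
    rw [levelThree, hδ]; congr 1; ring
  rw [← this]; exact h4

/-- The numerical inequality 4/e < √(2π/e) (i.e. 8/e < π), needed by `rungThree_of_bounds`. -/
theorem four_div_e_lt_sqrt : 4 / Real.exp 1 < Real.sqrt (2 * Real.pi / Real.exp 1) := by
  have he : 2.7182818283 < Real.exp 1 := Real.exp_one_gt_d9
  have he' : Real.exp 1 < 2.7182818286 := Real.exp_one_lt_d9
  have hpi : 3 < Real.pi := Real.pi_gt_three
  have hepos : 0 < Real.exp 1 := Real.exp_pos 1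
  have h4pos : 0 ≤ 4 / Real.exp 1 := by positivity
  rw [show 4 / Real.exp 1 = Real.sqrt ((4 / Real.exp 1) ^ 2) by rw [Real.sqrt_sq h4pos]]
  apply Real.sqrt_lt_sqrt (by positivity)
  rw [div_pow, lt_div_iff₀ hepos]
  have : (4 : ℝ) ^ 2 / Real.exp 1 ^ 2 * Real.exp 1 = 16 / Real.exp 1 := by
    field_simp; ring
  rw [this, div_lt_iff₀ hepos]
  nlinarith

end Summit.SmoothPoincare4.SmoothPoincare4.Cruxes.ThinCrossSectionExists.LadderSplit

end
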